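import Literature.Geometry.DiscreteGeometry.UnitDiscContactNumber
import Mathlib.Analysis.Complex.Basic
import HarnessLib

/-!
# Harborth's induction: the arithmetic of `[3n - √(12n - 3)]` and the peeling scheme

Topic `Literature/Geometry/DiscreteGeometry` (penny graphs / contact numbers), first file of the
proof of the UPPER BOUND in Harborth's theorem (H. Harborth, *Lösung zu Problem 664A*, Elem. Math.
**29** (1974) 14–15 [Harborth1974], inequality (5): every configuration of `n` congruent
non-overlapping discs has at most `[3n - √(12n - 3)]` contact points; = Heitmann–Radin 1980,
Theorem (1), upper half), i.e. of the named fact `Harborth1974_contactNumber` of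
`UnitDiscContactNumber.lean`.

Harborth's printed proof (p. 14–15) runs an induction on `n`: remove the `a` discs of the simple
closed boundary polygon; by the angle inequality (2) they carry at most `3a - 6` of the contacts,
"`B(n) ≤ B(n - a) + 3a - 6`" (Har-7), and by Euler's formula "(4) `n - a ≥ B(n) + 3 - 2n`", i.e.
`B(n) ≤ 3n - a - 3`; the two bounds combine to (5). This file isolates the part of that scheme
that is pure arithmetic and bookkeeping, for configurations rendered as FINITE SUBSETS OF `ℂ`
(`Finset ℂ`, centres pairwise at distance `≥ 1`, contact = distance exactly `1`; sub-configurations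
are sub-finsets, which is what makes the induction painless):

* §1 `harborthReal n = 3n - √(12n-3)` and `harborthNumber n = ⌊harborthReal n⌋`: monotone,
  SUPERADDITIVE across a shared disc, `f(m₁+1) + f(m₂+1) ≤ f(m₁+m₂+1)` (⇔ `(x-9)(y-9) ≥ 0` for
  `x = 12m₁+9`, `y = 12m₂+9`) — this is what lets configurations with a cut vertex or with two
  far-apart pieces be split instead of peeled (Harborth instead invokes maximality: "Eine maximale
  Lagerung muss notwendig derart zusammenhängend sein, dass kein Kreis alleine diesen Zusammenhang
  herstellt"; for the bound over ALL configurations we split) — and the PEEL STEP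
  `le_harborthNumber_of_peel`: `E ≤ 3n-a-3`, `E ≤ E' + 3a-6`, `E' ≤ f(n-a)`, `3 ≤ a ≤ n` ⇒ `E ≤ f(n)`
  (Harborth's closing computation (Har-8)–(5), done by the case split `a ≥ √(12n-3) - 3` or not).
* §2 vocabulary on `P : Finset ℂ`: `Harborth.nbrs P p` (unit-distance neighbours), `Harborth.darts P`
  (ordered contact pairs; `#darts = ∑ deg = 2 · #contact pairs`, `card_darts_eq_sum`),
  `Harborth.IsHard P` (centres pairwise `≥ 1` apart), `Harborth.Splits P` (the configuration is a
  disjoint union of two non-touching non-empty parts, or of two such parts and one further disc).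
* §3 THE INDUCTION THEOREM `Harborth.card_darts_le_of_boundary`: if every hard, non-splitting
  configuration of `n ≥ 4` discs admits a "boundary set" `S` of `a ≥ 3` discs with
  `∑_{v ∈ S} deg v ≤ 4a - 6`, at least `a` contact pairs inside `S`, and all degrees `≤ 6`, then
  EVERY hard configuration satisfies `#darts ≤ 2 ⌊3n - √(12n-3)⌋`. The point (ours, replacing
  Euler's formula in Harborth's argument): with `deg ≤ 6` off `S`, the single boundary inequality
  `∑_{S} deg ≤ 4a - 6` (which is Harborth's (2)) gives BOTH `2E = ∑ deg ≤ 6n - 2a - 6` (his (4)) and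
  `E ≤ E' + ∑_S deg - a ≤ E' + 3a - 6` (his (Har-7)).

The boundary set (the face-tracing cycle of the outer boundary, Hopf's Umlaufsatz, Jordan) is
supplied by the sequel files; the discharge `Harborth1974_contactNumber_holds` is the last of them.
Nothing here is specific to maximal configurations, and nothing is claimed about them.
-/

noncomputable section

namespace Literature.Geometry.DiscreteGeometry

open Finset

/-! ## §1 Arithmetic of Harborth's number -/

/-- The real number `3n - √(12n - 3)` whose integer part is Harborth's number (`Real.sqrt`, so the
value at `n = 0` is `0`). [cite: Harborth1974, (5)] -/
def harborthReal (n : ℕ) : ℝ := 3 * n - Real.sqrt (12 * n - 3)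

/-- `harborthNumber n = ⌊3n - √(12n - 3)⌋`. [cite: Harborth1974, (5)] -/
theorem harborthNumber_eq_floor (n : ℕ) : harborthNumber n = ⌊harborthReal n⌋ := rfl

/-- `√x ≤ y` from `x ≤ y²` (`y ≥ 0`). [folklore] -/
private theorem sqrt_le_of_le_sq {x y : ℝ} (hy : 0 ≤ y) (h : x ≤ y ^ 2) : Real.sqrt x ≤ y := by
  rw [← Real.sqrt_sq hy]
  exact Real.sqrt_le_sqrt h

/-- `3n - √(12n-3)` increases with `n` (one step). [cite: Harborth1974, (5)] -/
theorem harborthReal_le_succ (n : ℕ) : harborthReal n ≤ harborthReal (n + 1) := by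
  unfold harborthReal
  push_cast
  rcases Nat.eq_zero_or_pos n with rfl | hn
  · simp only [CharP.cast_eq_zero, mul_zero, zero_sub, zero_add, mul_one]
    have h1 : Real.sqrt (-3) = 0 := Real.sqrt_eq_zero'.2 (by norm_num)
    have h2 : Real.sqrt (12 - 3) = 3 := by
      rw [show (12 - 3 : ℝ) = 3 ^ 2 by norm_num, Real.sqrt_sq (by norm_num)]
    rw [h1, h2]; norm_num
  · have hn' : (1 : ℝ) ≤ n := by exact_mod_cast hn
    set s := Real.sqrt (12 * n - 3) with hs
    have hs0 : 0 ≤ 12 * (n : ℝ) - 3 := by linarith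
    have hs3 : 3 ≤ s := (Real.le_sqrt (by norm_num) hs0).2 (by linarith)
    have hsq : s ^ 2 = 12 * n - 3 := Real.sq_sqrt hs0
    have key : Real.sqrt (12 * (n + 1) - 3) ≤ s + 3 := by
      apply sqrt_le_of_le_sq (by linarith)
      nlinarith
    linarith

/-- `3n - √(12n-3)` is monotone in `n`. [cite: Harborth1974, (5)] -/
theorem harborthReal_mono : Monotone harborthReal :=
  monotone_nat_of_le_succ harborthReal_le_succ

/-- Harborth's number is monotone in `n`. [cite: Harborth1974, (5)] -/
theorem harborthNumber_mono : Monotone harborthNumber := fun _ _ h =>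
  Int.floor_le_floor (harborthReal_mono h)

/-- **Superadditivity across a shared disc.** `f(m₁ + 1) + f(m₂ + 1) ≤ f(m₁ + m₂ + 1)` for
`f(n) = 3n - √(12n-3)`: with `x = 12m₁ + 9`, `y = 12m₂ + 9` this is
`3 + √(x + y - 9) ≤ √x + √y`, i.e. `9(x + y - 9) ≤ xy`, i.e. `(x - 9)(y - 9) ≥ 0`. (Used to split a
configuration at a cut vertex: the two sides share one disc.) [cite: Harborth1974, (5)] -/
theorem harborthReal_add_le (m₁ m₂ : ℕ) :
    harborthReal (m₁ + 1) + harborthReal (m₂ + 1) ≤ harborthReal (m₁ + m₂ + 1) := by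
  unfold harborthReal
  push_cast
  set x : ℝ := 12 * m₁ + 9 with hx
  set y : ℝ := 12 * m₂ + 9 with hy
  have hm₁ : (0 : ℝ) ≤ m₁ := Nat.cast_nonneg _
  have hm₂ : (0 : ℝ) ≤ m₂ := Nat.cast_nonneg _
  have hx9 : 9 ≤ x := by rw [hx]; linarith
  have hy9 : 9 ≤ y := by rw [hy]; linarith
  have ex : (12 * (m₁ + 1 : ℝ) - 3) = x := by rw [hx]; ring
  have ey : (12 * (m₂ + 1 : ℝ) - 3) = y := by rw [hy]; ring
  have exy : (12 * (m₁ + m₂ + 1 : ℝ) - 3) = x + y - 9 := by rw [hx, hy]; ring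
  rw [ex, ey, exy]
  have hsx : 0 ≤ Real.sqrt x := Real.sqrt_nonneg _
  have hsy : 0 ≤ Real.sqrt y := Real.sqrt_nonneg _
  have hxx : Real.sqrt x ^ 2 = x := Real.sq_sqrt (by linarith)
  have hyy : Real.sqrt y ^ 2 = y := Real.sq_sqrt (by linarith)
  -- `3 √(x+y-9) ≤ √x √y`
  have h1 : 3 * Real.sqrt (x + y - 9) ≤ Real.sqrt x * Real.sqrt y := by
    rw [← Real.sqrt_mul (by linarith) y]
    have : 3 * Real.sqrt (x + y - 9) = Real.sqrt (9 * (x + y - 9)) := by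
      rw [Real.sqrt_mul (by norm_num), show (9 : ℝ) = 3 ^ 2 by norm_num, Real.sqrt_sq (by norm_num)]
    rw [this]
    exact Real.sqrt_le_sqrt (by nlinarith)
  -- `3 + √(x+y-9) ≤ √x + √y`
  have h2 : 3 + Real.sqrt (x + y - 9) ≤ Real.sqrt x + Real.sqrt y := by
    have hl : 0 ≤ 3 + Real.sqrt (x + y - 9) := by positivity
    have hxy9 : Real.sqrt (x + y - 9) ^ 2 = x + y - 9 := Real.sq_sqrt (by linarith)
    refine (pow_le_pow_iff_left₀ hl (by positivity) two_ne_zero).1 ?_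
    nlinarith
  linarith

/-- **Superadditivity of Harborth's number across a shared disc**:
`[f(m₁+1)] + [f(m₂+1)] ≤ [f(m₁+m₂+1)]`. [cite: Harborth1974, (5)] -/
theorem harborthNumber_add_le (m₁ m₂ : ℕ) :
    harborthNumber (m₁ + 1) + harborthNumber (m₂ + 1) ≤ harborthNumber (m₁ + m₂ + 1) := by
  rw [harborthNumber_eq_floor, harborthNumber_eq_floor, harborthNumber_eq_floor]
  exact (Int.le_floor_add _ _).trans (Int.floor_le_floor (harborthReal_add_le m₁ m₂))

/-- **Superadditivity of Harborth's number for disjoint pieces**: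
`[f(m₁+1)] + [f(m₂+1)] ≤ [f(m₁+m₂+2)]`. [cite: Harborth1974, (5)] -/
theorem harborthNumber_add_le' (m₁ m₂ : ℕ) :
    harborthNumber (m₁ + 1) + harborthNumber (m₂ + 1) ≤ harborthNumber (m₁ + m₂ + 2) :=
  (harborthNumber_add_le m₁ m₂).trans (harborthNumber_mono (by omega))

/-- The small values: for `n ≤ 3` Harborth's number is `n(n-1)/2` (`0, 0, 1, 3`), so that the
trivial bound "at most all pairs touch" is already Harborth's bound; stated as
`n(n-1) ≤ 2 [3n - √(12n-3)]`. (Harborth: "`B(1) = 0` und `B(2) = 1` leicht einzusehen, und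
`B(0) = 0` sei zusätzlich definiert.") [cite: Harborth1974, p. 14] -/
theorem mul_pred_le_two_mul_harborthNumber {n : ℕ} (hn : n ≤ 3) :
    ((n : ℤ) * (n - 1)) ≤ 2 * harborthNumber n := by
  have key : ∀ k : ℤ, (k : ℝ) ≤ harborthReal n → 2 * k ≤ 2 * harborthNumber n := fun k hk => by
    rw [harborthNumber_eq_floor]; have := Int.le_floor.2 hk; omega
  interval_cases n
  · have h1 : Real.sqrt (-3) = 0 := Real.sqrt_eq_zero'.2 (by norm_num)
    simpa using key 0 (by simp [harborthReal, h1])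
  · have : Real.sqrt (12 - 3) = 3 := by
      rw [show (12 - 3 : ℝ) = 3 ^ 2 by norm_num, Real.sqrt_sq (by norm_num)]
    simpa using key 0 (by simp [harborthReal, this])
  · have h : Real.sqrt (12 * 2 - 3) ≤ 5 := sqrt_le_of_le_sq (by norm_num) (by norm_num)
    have := key 1 (by simp only [harborthReal, Int.cast_one]; push_cast; linarith)
    simpa using this
  · have h : Real.sqrt (12 * 3 - 3) ≤ 6 := sqrt_le_of_le_sq (by norm_num) (by norm_num)
    have := key 3 (by simp only [harborthReal, Int.cast_ofNat]; push_cast; linarith)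
    simpa using this

/-- **The peel step** (Harborth, p. 15, (Har-8)–(5), re-done by a case split). If a configuration
of `n` discs has `E` contact pairs, removing `a` boundary discs (`3 ≤ a ≤ n`) leaves `E'` contact
pairs, and `E ≤ 3n - a - 3`, `E ≤ E' + 3a - 6`, `E' ≤ [3(n-a) - √(12(n-a)-3)]`, then
`E ≤ [3n - √(12n-3)]`: if `a ≥ √(12n-3) - 3` the first bound suffices; otherwise
`√(12n-3) > a + 3 ≥ 6` and `√(12(n-a)-3) > √(12n-3) - 6`, so the second does.
[cite: Harborth1974, (5)] -/
theorem le_harborthNumber_of_peel {n a : ℕ} {E E' : ℤ} (ha : 3 ≤ a) (han : a ≤ n)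
    (h1 : E ≤ 3 * n - a - 3) (h2 : E ≤ E' + 3 * a - 6) (hE' : E' ≤ harborthNumber (n - a)) :
    E ≤ harborthNumber n := by
  rw [harborthNumber_eq_floor, Int.le_floor]
  unfold harborthReal
  have ha' : (3 : ℝ) ≤ a := by exact_mod_cast ha
  have han' : (a : ℝ) ≤ n := by exact_mod_cast han
  have h1' : (E : ℝ) ≤ 3 * n - a - 3 := by exact_mod_cast h1
  have h2' : (E : ℝ) ≤ E' + 3 * a - 6 := by exact_mod_cast h2
  set r := Real.sqrt (12 * n - 3) with hr
  have hr0 : 0 ≤ 12 * (n : ℝ) - 3 := by linarith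
  have hrsq : r ^ 2 = 12 * n - 3 := Real.sq_sqrt hr0
  by_cases hc : r - 3 ≤ a
  · linarith
  · push Not at hc
    have hE'' : (E' : ℝ) ≤ harborthReal (n - a) := by
      have := (Int.cast_le (R := ℝ)).2 hE'
      exact this.trans (Int.floor_le _)
    unfold harborthReal at hE''
    rw [Nat.cast_sub han] at hE''
    have hr6 : 0 ≤ r - 6 := by linarith
    have key : r - 6 ≤ Real.sqrt (12 * (n - a : ℝ) - 3) := by
      rw [← Real.sqrt_sq hr6]
      exact Real.sqrt_le_sqrt (by nlinarith)
    linarith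

/-! ## §2 Configurations as finite subsets of `ℂ` -/

namespace Harborth

/-- The **unit-distance neighbours** of `p` in the configuration `P` (the discs touching the disc
centred at `p`, for unit-diameter discs). [cite: Harborth1974, p. 14] -/
def nbrs (P : Finset ℂ) (p : ℂ) : Finset ℂ := P.filter fun q => ‖q - p‖ = 1

/-- The **darts** (ordered contact pairs) of `P`: pairs `(p, q)` of centres at distance exactly
`1`. Their number is twice the number of contact points. [cite: Harborth1974, p. 14] -/
def darts (P : Finset ℂ) : Finset (ℂ × ℂ) := (P ×ˢ P).filter fun d => ‖d.2 - d.1‖ = 1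

/-- A **hard configuration**: distinct centres are at distance `≥ 1` ("je zwei von ihnen
höchstens einen Punkt gemeinsam haben", unit diameter). [cite: Harborth1974, p. 14] -/
def IsHard (P : Finset ℂ) : Prop := ∀ p ∈ P, ∀ q ∈ P, p ≠ q → 1 ≤ ‖q - p‖

/-- A configuration **splits** if it is the disjoint union of two non-empty parts with no contact
between them, or of one disc and two such parts (a cut vertex of the contact graph). Harborth
discards these by maximality; we split them by superadditivity. [cite: Harborth1974, p. 14] -/
def Splits (P : Finset ℂ) : Prop :=
  (∃ A B : Finset ℂ, A.Nonempty ∧ B.Nonempty ∧ Disjoint A B ∧ A ∪ B = P ∧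
      ∀ a ∈ A, ∀ b ∈ B, ‖b - a‖ ≠ 1) ∨
  (∃ (v : ℂ) (A B : Finset ℂ), v ∉ A ∧ v ∉ B ∧ A.Nonempty ∧ B.Nonempty ∧ Disjoint A B ∧
      insert v (A ∪ B) = P ∧ ∀ a ∈ A, ∀ b ∈ B, ‖b - a‖ ≠ 1)

variable {P : Finset ℂ}

/-- Membership in the neighbour set (unfolding of the rendering of "touching"). [cite: Harborth1974, p. 14] -/
@[simp] theorem mem_nbrs {p q : ℂ} : q ∈ nbrs P p ↔ q ∈ P ∧ ‖q - p‖ = 1 := by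
  simp [nbrs]

/-- Membership in the dart set (unfolding). [cite: Harborth1974, p. 14] -/
@[simp] theorem mem_darts {d : ℂ × ℂ} : d ∈ darts P ↔ (d.1 ∈ P ∧ d.2 ∈ P) ∧ ‖d.2 - d.1‖ = 1 := by
  simp [darts]

/-- The two ends of a dart are distinct (a disc does not touch itself). [cite: Harborth1974, p. 14] -/
theorem ne_of_mem_darts {d : ℂ × ℂ} (hd : d ∈ darts P) : d.1 ≠ d.2 := by
  intro h
  have := (mem_darts.1 hd).2
  rw [h, sub_self, norm_zero] at this
  exact zero_ne_one this

/-- A sub-configuration of a hard configuration is hard ("Werden dann die `a` Randkreise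
weggelassen, so bleiben `n - a` Kreise …"). [cite: Harborth1974, p. 14] -/
theorem IsHard.mono {Q : Finset ℂ} (hP : IsHard P) (hQ : Q ⊆ P) : IsHard Q :=
  fun p hp q hq hpq => hP p (hQ hp) q (hQ hq) hpq

/-- The darts of a sub-configuration are the darts with both ends in it. [cite: Harborth1974, p. 14] -/
theorem darts_subset_eq_filter {Q : Finset ℂ} (hQ : Q ⊆ P) :
    darts Q = (darts P).filter fun d => d.1 ∈ Q ∧ d.2 ∈ Q := by
  ext d
  simp only [mem_darts, mem_filter]
  constructor
  · rintro ⟨⟨h1, h2⟩, h3⟩; exact ⟨⟨⟨hQ h1, hQ h2⟩, h3⟩, h1, h2⟩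
  · rintro ⟨⟨-, h3⟩, h1, h2⟩; exact ⟨⟨h1, h2⟩, h3⟩

/-- The darts with a given tail `v ∈ P` are the pairs `(v, q)`, `q` a neighbour of `v`. [folklore] -/
private theorem filter_fst_eq_map {v : ℂ} (hv : v ∈ P) :
    ((darts P).filter fun d => d.1 = v) =
      (nbrs P v).map ⟨fun q => (v, q), fun _ _ h => (Prod.ext_iff.1 h).2⟩ := by
  ext ⟨p, q⟩
  simp only [mem_filter, mem_darts, mem_map, Function.Embedding.coeFn_mk, mem_nbrs, Prod.mk.injEq]
  constructor
  · rintro ⟨⟨⟨-, hq⟩, h1⟩, rfl⟩; exact ⟨q, ⟨hq, h1⟩, rfl, rfl⟩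
  · rintro ⟨q', ⟨hq', h1⟩, rfl, rfl⟩; exact ⟨⟨⟨hv, hq'⟩, h1⟩, rfl⟩

/-- **Handshake, tail form**: the darts with tail in `S ⊆ P` number `∑_{v ∈ S} deg v`.
[cite: Harborth1974, p. 14] -/
theorem card_filter_fst_mem {S : Finset ℂ} (hS : S ⊆ P) :
    ((darts P).filter fun d => d.1 ∈ S).card = ∑ v ∈ S, (nbrs P v).card := by
  have hmaps : Set.MapsTo Prod.fst (((darts P).filter fun d => d.1 ∈ S : Finset (ℂ × ℂ)) : Set (ℂ × ℂ))
      (S : Set ℂ) := fun d hd => mem_coe.2 (mem_filter.1 (mem_coe.1 hd)).2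
  rw [card_eq_sum_card_fiberwise hmaps]
  refine sum_congr rfl fun v hv => ?_
  have : ((darts P).filter fun d => d.1 ∈ S).filter (fun d => d.1 = v) =
      (darts P).filter fun d => d.1 = v := by
    ext d
    simp only [mem_filter]
    constructor
    · rintro ⟨⟨h1, -⟩, h3⟩; exact ⟨h1, h3⟩
    · rintro ⟨h1, h3⟩; exact ⟨⟨h1, h3 ▸ hv⟩, h3⟩
  rw [this, filter_fst_eq_map (hS hv), card_map]

/-- **Handshake**: `#darts = ∑_{v ∈ P} deg v` (twice the number of contact points).
[cite: Harborth1974, p. 14] -/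
theorem card_darts_eq_sum (P : Finset ℂ) : (darts P).card = ∑ v ∈ P, (nbrs P v).card := by
  rw [← card_filter_fst_mem (subset_refl P)]
  congr 1
  ext d
  simp only [mem_filter, mem_darts, iff_self_and]
  exact fun h => h.1.1

/-- The reversed dart is a dart (touching is symmetric). [cite: Harborth1974, p. 14] -/
theorem swap_mem_darts {d : ℂ × ℂ} (hd : d ∈ darts P) : d.swap ∈ darts P := by
  rw [mem_darts] at hd ⊢
  exact ⟨⟨hd.1.2, hd.1.1⟩, by rw [Prod.fst_swap, Prod.snd_swap, norm_sub_rev]; exact hd.2⟩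

/-- Reversal of darts, as an embedding. [folklore] -/
private def swapEmb : (ℂ × ℂ) ↪ (ℂ × ℂ) := (Equiv.prodComm ℂ ℂ).toEmbedding

/-- Unfolding of `swapEmb`. [folklore] -/
@[simp] private theorem swapEmb_apply (d : ℂ × ℂ) : swapEmb d = d.swap := rfl

/-- **Boundary bookkeeping.** For `S ⊆ P`:
`#darts(P) + #darts(S) = #darts(P ∖ S) + 2 ∑_{v ∈ S} deg_P v` — the darts of `P` are those inside
`P ∖ S`, those with tail in `S` (`∑_S deg` of them) and those with head in `S` and tail outside
(`∑_S deg - #darts(S)` of them). [cite: Harborth1974, p. 14] -/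
theorem card_darts_add_card_darts_eq {S : Finset ℂ} (hS : S ⊆ P) :
    (darts P).card + (darts S).card = (darts (P \ S)).card + 2 * ∑ v ∈ S, (nbrs P v).card := by
  classical
  set D := darts P with hD
  -- split by "tail in S"
  have e1 := card_filter_add_card_filter_not (s := D) (fun d => d.1 ∈ S)
  -- split the darts with tail outside `S` by "head in S"
  have e2 := card_filter_add_card_filter_not (s := D.filter fun d => ¬ d.1 ∈ S)
    (fun d => d.2 ∈ S)
  -- split the darts with tail in `S` by "head in S"
  have e3 := card_filter_add_card_filter_not (s := D.filter fun d => d.1 ∈ S)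
    (fun d => d.2 ∈ S)
  rw [filter_filter] at e2 e3
  rw [filter_filter] at e2 e3
  -- identify the pieces
  have hin : (D.filter fun d => d.1 ∈ S ∧ d.2 ∈ S) = darts S := by
    rw [hD, darts_subset_eq_filter hS]
  have hout : (D.filter fun d => ¬ d.1 ∈ S ∧ ¬ d.2 ∈ S) = darts (P \ S) := by
    rw [hD, darts_subset_eq_filter sdiff_subset]
    refine filter_congr fun d hd => ?_
    rw [mem_darts] at hd
    simp only [mem_sdiff, hd.1.1, hd.1.2, true_and]
  have hcross : (D.filter fun d => ¬ d.1 ∈ S ∧ d.2 ∈ S).card =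
      (D.filter fun d => d.1 ∈ S ∧ ¬ d.2 ∈ S).card := by
    rw [← card_map swapEmb]
    congr 1
    ext d
    simp only [mem_map, mem_filter, swapEmb_apply]
    constructor
    · rintro ⟨e, ⟨he, he1, he2⟩, rfl⟩
      exact ⟨swap_mem_darts he, by simpa using he2, by simpa using he1⟩
    · rintro ⟨hd, hd1, hd2⟩
      exact ⟨d.swap, ⟨swap_mem_darts hd, hd2, hd1⟩, Prod.swap_swap d⟩
  have htail := card_filter_fst_mem (P := P) hS
  rw [← hD] at htail
  rw [hin] at e3
  rw [hout, hcross] at e2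
  omega

/-! ### Contact pairs: half the darts -/

/-- The lexicographic order on `ℂ`, used only to pick one dart from each contact pair. [folklore] -/
private def lexLT (p q : ℂ) : Prop := p.re < q.re ∨ (p.re = q.re ∧ p.im < q.im)

/-- Trichotomy of the lexicographic order. [folklore] -/
private theorem lexLT_or_lexLT_of_ne {p q : ℂ} (h : p ≠ q) : lexLT p q ∨ lexLT q p := by
  unfold lexLT
  rcases lt_trichotomy p.re q.re with h1 | h1 | h1
  · exact Or.inl (Or.inl h1)
  · rcases lt_trichotomy p.im q.im with h2 | h2 | h2
    · exact Or.inl (Or.inr ⟨h1, h2⟩)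
    · exact absurd (Complex.ext h1 h2) h
    · exact Or.inr (Or.inr ⟨h1.symm, h2⟩)
  · exact Or.inr (Or.inl h1)

/-- Asymmetry of the lexicographic order. [folklore] -/
private theorem not_lexLT_of_lexLT {p q : ℂ} (h : lexLT p q) : ¬ lexLT q p := by
  unfold lexLT at *
  rintro (h' | ⟨h1, h2⟩) <;> rcases h with h | ⟨h3, h4⟩ <;> linarith

open Classical in
/-- The **contact pairs** (bonds) of `P`, each represented by its lexicographically increasing
dart. [cite: Harborth1974, p. 14] -/
private def bonds (P : Finset ℂ) : Finset (ℂ × ℂ) := (darts P).filter fun d => lexLT d.1 d.2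

/-- **Each contact pair carries exactly two darts**: `#darts = 2 · #bonds`. [folklore] -/
private theorem card_darts_eq_two_mul_card_bonds (P : Finset ℂ) : (darts P).card = 2 * (bonds P).card := by
  classical
  have hunion : darts P = bonds P ∪ (bonds P).map swapEmb := by
    ext d
    simp only [bonds, mem_union, mem_filter, mem_map, swapEmb_apply]
    constructor
    · intro hd
      rcases lexLT_or_lexLT_of_ne (ne_of_mem_darts hd) with h | h
      · exact Or.inl ⟨hd, h⟩
      · exact Or.inr ⟨d.swap, ⟨swap_mem_darts hd, h⟩, Prod.swap_swap d⟩
    · rintro (⟨hd, -⟩ | ⟨e, ⟨he, -⟩, rfl⟩)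
      · exact hd
      · exact swap_mem_darts he
  have hdisj : Disjoint (bonds P) ((bonds P).map swapEmb) := by
    rw [disjoint_left]
    rintro d hd hd'
    simp only [bonds, mem_filter, mem_map, swapEmb_apply] at hd hd'
    obtain ⟨e, ⟨-, he⟩, rfl⟩ := hd'
    exact not_lexLT_of_lexLT he (by simpa using hd.2)
  rw [hunion, card_union_of_disjoint hdisj, card_map]
  ring

/-! ### Splitting configurations -/

/-- Two non-touching parts: the darts are those of the parts. [cite: Harborth1974, p. 14] -/
theorem card_darts_of_split {A B : Finset ℂ} (hAB : Disjoint A B) (hP : A ∪ B = P)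
    (hno : ∀ a ∈ A, ∀ b ∈ B, ‖b - a‖ ≠ 1) :
    (darts P).card = (darts A).card + (darts B).card := by
  classical
  have hunion : darts P = darts A ∪ darts B := by
    ext d
    simp only [mem_union, mem_darts, ← hP]
    constructor
    · rintro ⟨⟨h1 | h1, h2 | h2⟩, h3⟩
      · exact Or.inl ⟨⟨h1, h2⟩, h3⟩
      · exact absurd h3 (hno _ h1 _ h2)
      · exact absurd (by rwa [norm_sub_rev] at h3) (hno _ h2 _ h1)
      · exact Or.inr ⟨⟨h1, h2⟩, h3⟩
    · rintro (⟨⟨h1, h2⟩, h3⟩ | ⟨⟨h1, h2⟩, h3⟩)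
      · exact ⟨⟨Or.inl h1, Or.inl h2⟩, h3⟩
      · exact ⟨⟨Or.inr h1, Or.inr h2⟩, h3⟩
  have hdisj : Disjoint (darts A) (darts B) := by
    rw [disjoint_left]
    intro d hdA hdB
    exact disjoint_left.1 hAB (mem_darts.1 hdA).1.1 (mem_darts.1 hdB).1.1
  rw [hunion, card_union_of_disjoint hdisj]

/-- Two parts touching only through one further disc `v`: the darts are those of the two parts
with `v` adjoined (no dart lies in both, as `v` does not touch itself). [cite: Harborth1974, p. 14] -/
theorem card_darts_of_split_vertex {v : ℂ} {A B : Finset ℂ}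
    (hAB : Disjoint A B) (hP : insert v (A ∪ B) = P) (hno : ∀ a ∈ A, ∀ b ∈ B, ‖b - a‖ ≠ 1) :
    (darts P).card = (darts (insert v A)).card + (darts (insert v B)).card := by
  classical
  have hunion : darts P = darts (insert v A) ∪ darts (insert v B) := by
    ext d
    simp only [mem_union, mem_darts, ← hP, mem_insert, mem_union]
    constructor
    · rintro ⟨⟨h1, h2⟩, h3⟩
      rcases h1 with h1 | h1 | h1 <;> rcases h2 with h2 | h2 | h2
      · exact Or.inl ⟨⟨Or.inl h1, Or.inl h2⟩, h3⟩
      · exact Or.inl ⟨⟨Or.inl h1, Or.inr h2⟩, h3⟩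
      · exact Or.inr ⟨⟨Or.inl h1, Or.inr h2⟩, h3⟩
      · exact Or.inl ⟨⟨Or.inr h1, Or.inl h2⟩, h3⟩
      · exact Or.inl ⟨⟨Or.inr h1, Or.inr h2⟩, h3⟩
      · exact absurd h3 (hno _ h1 _ h2)
      · exact Or.inr ⟨⟨Or.inr h1, Or.inl h2⟩, h3⟩
      · exact absurd (by rwa [norm_sub_rev] at h3) (hno _ h2 _ h1)
      · exact Or.inr ⟨⟨Or.inr h1, Or.inr h2⟩, h3⟩
    · rintro (⟨⟨h1, h2⟩, h3⟩ | ⟨⟨h1, h2⟩, h3⟩)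
      · exact ⟨⟨h1.imp_right Or.inl, h2.imp_right Or.inl⟩, h3⟩
      · exact ⟨⟨h1.imp_right Or.inr, h2.imp_right Or.inr⟩, h3⟩
  have hdisj : Disjoint (darts (insert v A)) (darts (insert v B)) := by
    rw [disjoint_left]
    intro d hdA hdB
    have h1 := (mem_darts.1 hdA).1
    have h2 := (mem_darts.1 hdB).1
    simp only [mem_insert] at h1 h2
    have e1 : d.1 = v := by
      rcases h1.1 with h | h; · exact h
      rcases h2.1 with h' | h'; · exact h'
      exact absurd h' (disjoint_left.1 hAB h)
    have e2 : d.2 = v := by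
      rcases h1.2 with h | h; · exact h
      rcases h2.2 with h' | h'; · exact h'
      exact absurd h' (disjoint_left.1 hAB h)
    exact ne_of_mem_darts hdA (e1.trans e2.symm)
  rw [hunion, card_union_of_disjoint hdisj]

/-! ## §3 The induction -/

/-- The darts form a subset of the off-diagonal pairs; so `#darts ≤ n(n-1)` ("`B(1) = 0` und
`B(2) = 1` leicht einzusehen"). [cite: Harborth1974, p. 14] -/
theorem card_darts_le_offDiag (P : Finset ℂ) : ((darts P).card : ℤ) ≤ (P.card : ℤ) * (P.card - 1) := by
  have hsub : darts P ⊆ P.offDiag := fun d hd =>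
    mem_offDiag.2 ⟨(mem_darts.1 hd).1.1, (mem_darts.1 hd).1.2, ne_of_mem_darts hd⟩
  have h := card_le_card hsub
  rw [offDiag_card] at h
  have h' : ((darts P).card : ℤ) ≤ ((P.card * P.card - P.card : ℕ) : ℤ) := by exact_mod_cast h
  rw [Nat.cast_sub (Nat.le_mul_self _)] at h'
  push_cast at h'
  linarith

/-- **Harborth's induction (upper bound), abstract form.** Suppose every hard configuration of
`n ≥ 4` discs that does not split has a set `S` of `a ≥ 3` of its discs ("the boundary discs")
with `∑_{v ∈ S} deg v ≤ 4a - 6` (Harborth's angle inequality (2), summed), with at least `a`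
contact pairs among the discs of `S` (the boundary polygon), and all degrees are `≤ 6` ("Jeder
Kreis wird von höchstens sechs anderen berührt"). Then every hard configuration of `n` discs has at
most `[3n - √(12n-3)]` contact pairs (`#darts ≤ 2 [3n - √(12n-3)]`). Proof: strong induction on
`n`; `n ≤ 3` is trivial; a splitting configuration is bounded by superadditivity; otherwise
`2E = ∑ deg ≤ (4a-6) + 6(n-a)` gives (4) `E ≤ 3n - a - 3`, the bookkeeping identity gives (Har-7)
`E ≤ E' + ∑_S deg - a ≤ E' + 3a - 6` with `E'` the contact pairs of `P ∖ S`, and the peel step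
concludes. [cite: Harborth1974, (2)–(5)] -/
theorem card_darts_le_of_boundary
    (H : ∀ P : Finset ℂ, IsHard P → 4 ≤ P.card → ¬ Splits P →
      ∃ S ⊆ P, 3 ≤ S.card ∧ (∑ v ∈ S, ((nbrs P v).card : ℤ)) + 6 ≤ 4 * S.card ∧
        2 * S.card ≤ (darts S).card ∧ ∀ v ∈ P, (nbrs P v).card ≤ 6)
    (P : Finset ℂ) (hP : IsHard P) : ((darts P).card : ℤ) ≤ 2 * harborthNumber P.card := by
  classical
  suffices main : ∀ n (P : Finset ℂ), IsHard P → P.card = n →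
      ((darts P).card : ℤ) ≤ 2 * harborthNumber P.card from main _ P hP rfl
  intro n
  induction n using Nat.strong_induction_on with
  | _ n ih =>
  intro P hP hn
  by_cases h3 : n ≤ 3
  · -- at most all pairs touch
    refine (card_darts_le_offDiag P).trans ?_
    rw [hn]
    exact mul_pred_le_two_mul_harborthNumber h3
  have h4 : 4 ≤ P.card := by omega
  by_cases hs : Splits P
  · rcases hs with ⟨A, B, hA, hB, hAB, hABP, hno⟩ | ⟨v, A, B, hvA, hvB, hA, hB, hAB, hABP, hno⟩
    · -- two far-apart pieces
      have hcard : A.card + B.card = n := by rw [← card_union_of_disjoint hAB, hABP, hn]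
      have hA1 := hA.card_pos
      have hB1 := hB.card_pos
      have ihA := ih A.card (by omega) A (hP.mono (hABP ▸ subset_union_left)) rfl
      have ihB := ih B.card (by omega) B (hP.mono (hABP ▸ subset_union_right)) rfl
      rw [card_darts_of_split hAB hABP hno]
      push_cast
      obtain ⟨m₁, hm₁⟩ : ∃ m, A.card = m + 1 := ⟨A.card - 1, by omega⟩
      obtain ⟨m₂, hm₂⟩ : ∃ m, B.card = m + 1 := ⟨B.card - 1, by omega⟩
      have key := harborthNumber_add_le' m₁ m₂
      rw [← hm₁, ← hm₂, show m₁ + m₂ + 2 = P.card by omega] at key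
      linarith
    · -- a cut vertex `v`
      have hvAB : v ∉ A ∪ B := by simp [hvA, hvB]
      have hcard : A.card + B.card + 1 = n := by
        rw [← hn, ← hABP, card_insert_of_notMem hvAB, card_union_of_disjoint hAB]
      have hA1 := hA.card_pos
      have hB1 := hB.card_pos
      have hcA : (insert v A).card = A.card + 1 := card_insert_of_notMem hvA
      have hcB : (insert v B).card = B.card + 1 := card_insert_of_notMem hvB
      have hsubA : insert v A ⊆ P := by
        rw [← hABP]; exact insert_subset_insert v subset_union_left
      have hsubB : insert v B ⊆ P := by
        rw [← hABP]; exact insert_subset_insert v subset_union_right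
      have ihA := ih (insert v A).card (by omega) (insert v A) (hP.mono hsubA) rfl
      have ihB := ih (insert v B).card (by omega) (insert v B) (hP.mono hsubB) rfl
      rw [card_darts_of_split_vertex hAB hABP hno]
      push_cast
      have key := harborthNumber_add_le A.card B.card
      rw [← hcA, ← hcB, show A.card + B.card + 1 = P.card by omega] at key
      linarith
  · -- no split: peel the boundary set
    obtain ⟨S, hSP, hS3, hdeg, hcyc, hsix⟩ := H P hP h4 hs
    set a := S.card with ha
    have haP : a ≤ P.card := card_le_card hSP
    -- (4): `#darts ≤ 6n - 2a - 6`
    have hsum := card_darts_eq_sum P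
    rw [← sum_sdiff hSP] at hsum
    have hout : ∑ v ∈ P \ S, (nbrs P v).card ≤ 6 * (P.card - a) := by
      have := sum_le_card_nsmul (P \ S) (fun v => (nbrs P v).card) 6
        (fun v hv => hsix v (sdiff_subset hv))
      rw [card_sdiff_of_subset hSP, smul_eq_mul] at this
      linarith
    have h1 : ((darts P).card : ℤ) ≤ 6 * P.card - 2 * a - 6 := by
      have e : ((darts P).card : ℤ) = (∑ v ∈ P \ S, (nbrs P v).card : ℕ) +
          ∑ v ∈ S, ((nbrs P v).card : ℤ) := by
        rw [hsum]; push_cast; ring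
      have hout' : ((∑ v ∈ P \ S, (nbrs P v).card : ℕ) : ℤ) ≤ 6 * ((P.card - a : ℕ) : ℤ) := by
        exact_mod_cast hout
      rw [Nat.cast_sub haP] at hout'
      linarith
    -- (Har-7): `#darts ≤ #darts(P \ S) + 6a - 12`
    have hbook := card_darts_add_card_darts_eq (P := P) hSP
    have h2 : ((darts P).card : ℤ) ≤ (darts (P \ S)).card + 6 * a - 12 := by
      have e : ((darts P).card : ℤ) + (darts S).card =
          (darts (P \ S)).card + 2 * ∑ v ∈ S, ((nbrs P v).card : ℤ) := by
        exact_mod_cast hbook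
      have hcyc' : (2 * a : ℤ) ≤ (darts S).card := by exact_mod_cast hcyc
      linarith
    -- halve everything
    have hE := card_darts_eq_two_mul_card_bonds P
    have hE' := card_darts_eq_two_mul_card_bonds (P \ S)
    have hcard' : (P \ S).card = P.card - a := card_sdiff_of_subset hSP
    have ih' := ih (P \ S).card (by rw [hcard']; omega) (P \ S) (hP.mono sdiff_subset) rfl
    rw [hcard'] at ih'
    have key := le_harborthNumber_of_peel (n := P.card) (a := a) (E := (bonds P).card)
      (E' := (bonds (P \ S)).card) hS3 haP (by omega) (by omega) (by omega)
    rw [hE]; push_cast; linarith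

end Harborth

end Literature.Geometry.DiscreteGeometry

end
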